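import Summits.BirchSwinnertonDyer.Rank1Residual.Ordinary.KummerLineLocalTriviality
import HarnessLib

/-!
# The strict `p`-Selmer group in rank one: its order is `p^m · #(image in Ш[p^∞])`, the kernel part is
# EXACTLY `p^m` (`m` = the local divisibility level of the Mordell–Weil generator), and it is
# `p^m · #Ш(E/K)[p^∞]` as soon as `Sel_{p^∞} = im κ + Sel_0` — R1-DEPTH-LAW §2 (i)'s count
# «length Sel_0 = m_p + v_p #Ш» on the tree's REAL global objects (theorems only — no definition, no named
# fact, nothing asserted about any curve's BSD; C-16 stays a CONJECTURE)

HONEST FRAMING (cell `b2b-bsdres`, run/shared/lean/b2b/bsd-rank1-residual/, verbatim in every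
file): the goal of the cell is to DELETE the COMBINATION-SHAPED residual classes of the
Birch–Swinnerton-Dyer formula for ALL analytic-rank `≤ 1` elliptic curves over `ℚ` — "full BSD
formula for every rank `≤ 1` curve in class `C`" assembled STRICTLY from published theorems — so
that the rank-`≤ 1` remainder becomes exactly the CONSTRUCTION-SHAPED classes, which are TYPED
(missing-input `Prop`s), NOT attempted. This is not "finishing BSD". Seat `b2b-bsdres-additive-p3`
(X8 prover B / X7 joint; typer-designate for the cell conjecture C-16 = hyp C120.1 by hyp R-16 (e)).
This file books nothing and moves no mark; X7 / X8 stay CONSTRUCTION-SHAPED.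

## What this file does

The derivation of the rank-one depth law (`HOME/b2b-bsdres-additive-p3/R1-DEPTH-LAW.md` §2) has a
GLOBAL arithmetic input in its step (i): for `E/ℚ` of rank one with `Ш[p^∞]` finite, the `p`-strict
Selmer group `Sel_0(ℚ, E[p^∞]) = ker (Sel_{p^∞}(E/ℚ) → H¹(ℚ_p, E[p^∞]))` is finite of length
`m_p + length Ш[p^∞]`, `m_p = m_p(P₁)` the local divisibility level of the Mordell–Weil generator (the
largest `m` with `P₁ ∈ p^m E(ℚ_p) + E(ℚ_p)_tors`). The tree has the GLOBAL objects
(`Literature/NumberTheory/EllipticCurves/`: `selmerGroupPInfty`; `selmerLocalKerPrimaryTorsion W E p` = the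
kernel of `H¹(K, E[p^∞]) → H¹(E, E(K̄_E)[p^∞])` at a `K`-field `E`; the `p^∞` Kummer map, `Sel_{p^∞} ↠ Ш[p^∞]`
(`SelmerCorankProofs`); `StrictSelmerRankOne`: `Sel_0` is FINITE in rank one — Kim 2022 / Skinner 2020).
This file proves the EXACT COUNT, for `W` over a number field `K`, a prime `p`, a perfect `K`-field `E`,
`P₁` generating `E(K)` modulo torsion and `m` with `P₁ ∈ p^m E(E) + tors`, `P₁ ∉ p^{m+1} E(E) + tors`
(hypotheses of the statements; siblings `PrimaryTorsionAlgebra`, `KummerLineLocalTriviality`):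
* §3 **kernel count** `natCard_strictSelmer_inf_ker_eq_pow`: `#(Sel_0 ∩ im κ) = p^m` EXACTLY (the locally
  trivial part of the Kummer line is `(ℚ_p/ℤ_p)[p^m]`, `comap_kummerPruferHom_selmerLocalKer_eq_torsionBy`);
* §4 **index formula** `natCard_strictSelmer_eq_pow_mul_natCard_map`: `#Sel_0 = p^m · #(image in H¹(K,E))`,
  the image inside `Ш[p^∞]`; `natCard_strictSelmer_le` (`≤ p^m · #Ш[p^∞]`), `pow_dvd_natCard_strictSelmer`,
  and `natCard_strictSelmer_eq_pow_mul_natCard_sha`: `#Sel_0 = p^m · #Ш[p^∞]` under «`Sel_{p^∞} = im κ + Sel_0`»;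
* §5 **surjectivity criterion** `forall_exists_sub_kummerPruferHom_mem`: «`Sel_{p^∞} = im κ + Sel_0`» holds
  when `Sel_{p^∞}` satisfies the Selmer condition at `E` (automatic at a completion) and the kernel `L_E` of
  `H¹(E, E(K̄_E)[p^∞]) → H¹(E, E(K̄_E))` has at most `p` elements killed by `p` (for `E = ℚ_p`:
  `L_{ℚ_p} ≅ E(ℚ_p) ⊗ ℚ_p/ℤ_p ≅ ℚ_p/ℤ_p`, Kim 2022 AJM Lemma 5.1 — NOT proved here, displayed as `hL`);
* §6 `natCard_strictSelmer_adicCompletion_eq`: the count at a finite place `v` of `K` modulo `hL` only.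

What is NOT here: `#L_{K_v}[p] = p^{[K_v:ℚ_p]}` (local Kummer theory of `E(K_v) ⊗ ℚ_p/ℤ_p`), and the
cohomological side of Mazur–Rubin Thm 5.2.12 (`∂⁰(κ) − ∂^∞(κ) = length Sel_0`), which stays the named
missing input of C-16 (`C16-KERNEL-DIGEST.md` §4).

References: C.-H. Kim, *The structure of Selmer groups and the Iwasawa main conjecture for elliptic
curves*, Amer. J. Math. = arXiv:2203.12159, §5.1 eq. (5.1), Lemma 5.1 [Kim2022StructureSelmer]; B. Mazur,
K. Rubin, *Kolyvagin systems*, Mem. AMS 799 (2004), Thm 5.2.12 [MazurRubin2004]; R. Greenberg, LNM 1716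
(1999), §2 [Greenberg1999LNM]; C. Skinner, Ann. of Math. 191 (2020), §2.2 [Skinner2020]; J. H. Silverman,
AEC 2nd ed. (2009), VIII.§2, X.§4 [SilvermanAEC2009]; `R1-DEPTH-LAW.md` §2 (i).
-/

noncomputable section

open scoped Classical
open scoped AddSubgroup

open WeierstrassCurve Literature.NumberTheory.EllipticCurves
  Literature.NumberTheory.GaloisRepresentations

universe u

namespace Summit.BirchSwinnertonDyer.Rank1Residual.Ordinary

section StrictSelmer

variable {K : Type u} [Field K] [NumberField K] (W : WeierstrassCurve K) [W.IsElliptic]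
variable (p : ℕ) [hp : Fact p.Prime]
variable (E : Type u) [Field E] [Algebra K E] [PerfectField E]

/-! ### §3 The kernel count: the locally trivial part of the Kummer line is `(ℚ_p/ℤ_p)[p^m]` -/

omit [NumberField K] in
/-- **The locally trivial part of the Kummer line is the `p^m`-torsion of `ℚ_p/ℤ_p`**, `m` the
`E`-divisibility level of `P₁` modulo torsion: `κ([a/p^N] ⊗ P₁) ↦ 0` at `E` iff `a • P₁ ∈ p^N E(E) + tors`
(§2) iff `p^{N-m} ∣ a` (§1) iff `p^m` kills `[a/p^N]`. [folklore] -/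
theorem comap_kummerPruferHom_selmerLocalKer_eq_torsionBy {P₁ : W.toAffine.Point} {m : ℕ}
    (hm : ∃ R T : (W.baseChange E).toAffine.Point, IsOfFinAddOrder T ∧
      Affine.Point.baseChange (W' := W) K E P₁ = p ^ m • R + T)
    (hm1 : ¬ ∃ R T : (W.baseChange E).toAffine.Point, IsOfFinAddOrder T ∧
      Affine.Point.baseChange (W' := W) K E P₁ = p ^ (m + 1) • R + T) :
    (selmerLocalKerPrimaryTorsion W E p).comap (kummerPruferHom W p W.zsmul_geomPoints_surjective_holds P₁) =
      (PruferQuot p)[((p ^ m : ℕ) : ℤ)] := by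
  let bc : W.toAffine.Point →+ (W.baseChange E).toAffine.Point :=
    Affine.Point.baseChange (W' := W) K E
  ext x
  obtain ⟨N, a, rfl⟩ := exists_eq_zsmul_prufGen p x
  rw [AddSubgroup.mem_comap, AddSubgroup.torsionBy.nsmul_iff, ← natCast_zsmul, smul_smul,
    zsmul_prufGen_eq_zero_iff, Int.natCast_pow,
    pow_dvd_pow_mul_iff_pow_sub_dvd (Int.natCast_ne_zero.mpr hp.out.ne_zero),
    ← exists_eq_pow_smul_add_torsion_zsmul_iff hp.out hm hm1 N a, map_zsmul,
    kummerPruferHom_prufGen, ← map_zsmul]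
  change resH1Hom (resGal (K := K) E) (primaryPointsMap W E p) (primaryPointsMap_smul W E p)
      (kummerMapLevel W p W.zsmul_geomPoints_surjective_holds N (a • P₁)) = 0 ↔ _
  rw [res_kummerMapLevel_eq_zero_iff]
  change (∃ R T, IsOfFinAddOrder T ∧ bc (a • P₁) = p ^ N • R + T) ↔
    ∃ R T, IsOfFinAddOrder T ∧ a • bc P₁ = p ^ N • R + T
  rw [map_zsmul]

/-- **THE KERNEL COUNT: `#(Sel_0 ∩ im κ) = p^m` exactly.** The part of the `p`-strict Selmer group
`Sel_{p^∞}(E/K) ∩ ker (H¹(K,E[p^∞]) → H¹(E, E(K̄_E)[p^∞]))` dying in `H¹(K, E)` is the image of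
`(ℚ_p/ℤ_p)[p^m]` under the (injective) Kummer line of the generator `P₁`, hence has exactly `p^m`
elements, `m` = the `E`-divisibility level of `P₁` modulo torsion (`m_p(P₁)` for `E = ℚ_p`). This is the
`m_p` of R1-DEPTH-LAW §2 (i) («the map being `×p^{m_p}·unit` on the divisible part»).
[cite: Kim2022StructureSelmer, §5.1 eq. (5.1)] -/
theorem natCard_strictSelmer_inf_ker_eq_pow {P₁ : W.toAffine.Point} (hP₁ : ¬ IsOfFinAddOrder P₁)
    (hgen : ∀ P : W.toAffine.Point, ∃ (a : ℤ) (t : W.toAffine.Point),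
      IsOfFinAddOrder t ∧ P = a • P₁ + t) {m : ℕ}
    (hm : ∃ R T : (W.baseChange E).toAffine.Point, IsOfFinAddOrder T ∧
      Affine.Point.baseChange (W' := W) K E P₁ = p ^ m • R + T)
    (hm1 : ¬ ∃ R T : (W.baseChange E).toAffine.Point, IsOfFinAddOrder T ∧
      Affine.Point.baseChange (W' := W) K E P₁ = p ^ (m + 1) • R + T) :
    Nat.card ↥((W.selmerGroupPInfty p ⊓ selmerLocalKerPrimaryTorsion W E p) ⊓
      (primaryH1ToH1 W p).ker) = p ^ m := by
  have hker : (W.selmerGroupPInfty p ⊓ selmerLocalKerPrimaryTorsion W E p) ⊓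
      (primaryH1ToH1 W p).ker =
        ((PruferQuot p)[((p ^ m : ℕ) : ℤ)]).map (kummerPruferHom W p W.zsmul_geomPoints_surjective_holds P₁) := by
    rw [← comap_kummerPruferHom_selmerLocalKer_eq_torsionBy W p E hm hm1,
      AddSubgroup.map_comap_eq, range_kummerPruferHom_eq_ker W p W.zsmul_geomPoints_surjective_holds hgen, inf_comm,
      ← inf_assoc, inf_eq_left.mpr (ker_primaryH1ToH1_le_selmerGroupPInfty W p)]
  rw [hker, AddSubgroup.card_map_of_injective (kummerPruferHom_injective W p W.zsmul_geomPoints_surjective_holds hP₁ hgen),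
    natCard_torsionBy_pruferQuot_pow]

/-! ### §4 The index formula `#Sel_0 = p^m · #(image in Ш[p^∞])` -/

/-- **THE INDEX FORMULA.** `#Sel_0 = p^m · #(image of Sel_0 in H¹(K, E))`: the map `Sel_0 → H¹(K,E)`
has kernel `Sel_0 ∩ im κ` of order exactly `p^m` (§3). [cite: Kim2022StructureSelmer, §5.1 eq. (5.1)] -/
theorem natCard_strictSelmer_eq_pow_mul_natCard_map {P₁ : W.toAffine.Point}
    (hP₁ : ¬ IsOfFinAddOrder P₁)
    (hgen : ∀ P : W.toAffine.Point, ∃ (a : ℤ) (t : W.toAffine.Point),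
      IsOfFinAddOrder t ∧ P = a • P₁ + t) {m : ℕ}
    (hm : ∃ R T : (W.baseChange E).toAffine.Point, IsOfFinAddOrder T ∧
      Affine.Point.baseChange (W' := W) K E P₁ = p ^ m • R + T)
    (hm1 : ¬ ∃ R T : (W.baseChange E).toAffine.Point, IsOfFinAddOrder T ∧
      Affine.Point.baseChange (W' := W) K E P₁ = p ^ (m + 1) • R + T) :
    Nat.card ↥(W.selmerGroupPInfty p ⊓ selmerLocalKerPrimaryTorsion W E p) =
      p ^ m * Nat.card ↥((W.selmerGroupPInfty p ⊓ selmerLocalKerPrimaryTorsion W E p).map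
        (primaryH1ToH1 W p)) := by
  set S₀ := W.selmerGroupPInfty p ⊓ selmerLocalKerPrimaryTorsion W E p with hS₀
  set πS : S₀ →+ W.galH1 := (primaryH1ToH1 W p).comp S₀.subtype with hπS
  have hrange : πS.range = S₀.map (primaryH1ToH1 W p) := by
    rw [hπS, AddMonoidHom.range_comp, AddSubgroup.range_subtype]
  have hkerS : πS.ker = (S₀ ⊓ (primaryH1ToH1 W p).ker).addSubgroupOf S₀ := by
    rw [hπS, ← AddMonoidHom.comap_ker, AddSubgroup.inf_addSubgroupOf_left]
    rfl
  have hkcard : Nat.card πS.ker = p ^ m := by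
    rw [hkerS, Nat.card_congr (AddSubgroup.addSubgroupOfEquivOfLe inf_le_left).toEquiv]
    exact natCard_strictSelmer_inf_ker_eq_pow W p E hP₁ hgen hm hm1
  rw [AddSubgroup.card_eq_card_quotient_mul_card_addSubgroup πS.ker, hkcard,
    Nat.card_congr (QuotientAddGroup.quotientKerEquivRange πS).toEquiv, hrange, mul_comm]

omit hp [PerfectField E] in
/-- The image of the strict Selmer group in `H¹(K, E)` lies in `Ш(E/K)[p^∞]` (the image of the whole
`Sel_{p^∞}`, tree `map_primaryH1ToH1_selmerGroupPInfty`). Greenberg 1999 §2. [folklore] -/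
theorem map_strictSelmer_le_sha [Fact p.Prime] :
    (W.selmerGroupPInfty p ⊓ selmerLocalKerPrimaryTorsion W E p).map (primaryH1ToH1 W p) ≤
      (AddCommGroup.primaryComponent W.sha p).map W.sha.subtype := by
  rw [← map_primaryH1ToH1_selmerGroupPInfty W p W.zsmul_geomPoints_surjective_holds]
  exact AddSubgroup.map_mono inf_le_left

/-- **UPPER BOUND `#Sel_0 ≤ p^m · #Ш[p^∞]`** (with `Ш[p^∞]` finite): the index formula with the image
bounded by `Ш[p^∞]`. [cite: Kim2022StructureSelmer, §5.1 eq. (5.1)] -/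
theorem natCard_strictSelmer_le {P₁ : W.toAffine.Point} (hP₁ : ¬ IsOfFinAddOrder P₁)
    (hgen : ∀ P : W.toAffine.Point, ∃ (a : ℤ) (t : W.toAffine.Point),
      IsOfFinAddOrder t ∧ P = a • P₁ + t) {m : ℕ}
    (hm : ∃ R T : (W.baseChange E).toAffine.Point, IsOfFinAddOrder T ∧
      Affine.Point.baseChange (W' := W) K E P₁ = p ^ m • R + T)
    (hm1 : ¬ ∃ R T : (W.baseChange E).toAffine.Point, IsOfFinAddOrder T ∧
      Affine.Point.baseChange (W' := W) K E P₁ = p ^ (m + 1) • R + T)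
    [Finite (AddCommGroup.primaryComponent W.sha p)] :
    Nat.card ↥(W.selmerGroupPInfty p ⊓ selmerLocalKerPrimaryTorsion W E p) ≤
      p ^ m * Nat.card (AddCommGroup.primaryComponent W.sha p) := by
  rw [natCard_strictSelmer_eq_pow_mul_natCard_map W p E hP₁ hgen hm hm1]
  refine Nat.mul_le_mul_left _ ?_
  haveI : Finite ((AddCommGroup.primaryComponent W.sha p).map W.sha.subtype) :=
    Finite.of_equiv _ (AddSubgroup.equivMapOfInjective _ _ W.sha.subtype_injective).toEquiv
  calc Nat.card ↥((W.selmerGroupPInfty p ⊓ selmerLocalKerPrimaryTorsion W E p).map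
        (primaryH1ToH1 W p))
      ≤ Nat.card ((AddCommGroup.primaryComponent W.sha p).map W.sha.subtype) :=
        AddSubgroup.card_le_of_le (map_strictSelmer_le_sha W p E)
    _ = Nat.card (AddCommGroup.primaryComponent W.sha p) :=
        AddSubgroup.card_map_of_injective W.sha.subtype_injective

/-- **`p^m ∣ #Sel_0`** (the kernel part alone). [folklore] -/
theorem pow_dvd_natCard_strictSelmer {P₁ : W.toAffine.Point} (hP₁ : ¬ IsOfFinAddOrder P₁)
    (hgen : ∀ P : W.toAffine.Point, ∃ (a : ℤ) (t : W.toAffine.Point),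
      IsOfFinAddOrder t ∧ P = a • P₁ + t) {m : ℕ}
    (hm : ∃ R T : (W.baseChange E).toAffine.Point, IsOfFinAddOrder T ∧
      Affine.Point.baseChange (W' := W) K E P₁ = p ^ m • R + T)
    (hm1 : ¬ ∃ R T : (W.baseChange E).toAffine.Point, IsOfFinAddOrder T ∧
      Affine.Point.baseChange (W' := W) K E P₁ = p ^ (m + 1) • R + T) :
    p ^ m ∣ Nat.card ↥(W.selmerGroupPInfty p ⊓ selmerLocalKerPrimaryTorsion W E p) :=
  Dvd.intro _ (natCard_strictSelmer_eq_pow_mul_natCard_map W p E hP₁ hgen hm hm1).symm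

/-- **`#Sel_0 = p^m · #Ш(E/K)[p^∞]` when `Sel_{p^∞} = im κ + Sel_0`** (every Selmer class is locally
trivial at `E` up to a class of the Kummer line): then `Sel_0` and `Sel_{p^∞}` have the same image
`Ш[p^∞]` in `H¹(K, E)`. This is «`length Sel_0 = m_p + length Ш[p^∞]`» of R1-DEPTH-LAW §2 (i), the
surjectivity being Kim 2022 Lemma 5.1 / eq. (5.1) at `E = ℚ_p` (criterion: §5).
[cite: Kim2022StructureSelmer, §5.1 eq. (5.1) and Lemma 5.1] -/
theorem natCard_strictSelmer_eq_pow_mul_natCard_sha {P₁ : W.toAffine.Point}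
    (hP₁ : ¬ IsOfFinAddOrder P₁)
    (hgen : ∀ P : W.toAffine.Point, ∃ (a : ℤ) (t : W.toAffine.Point),
      IsOfFinAddOrder t ∧ P = a • P₁ + t) {m : ℕ}
    (hm : ∃ R T : (W.baseChange E).toAffine.Point, IsOfFinAddOrder T ∧
      Affine.Point.baseChange (W' := W) K E P₁ = p ^ m • R + T)
    (hm1 : ¬ ∃ R T : (W.baseChange E).toAffine.Point, IsOfFinAddOrder T ∧
      Affine.Point.baseChange (W' := W) K E P₁ = p ^ (m + 1) • R + T)
    (hsurj : ∀ c ∈ W.selmerGroupPInfty p, ∃ x : PruferQuot p,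
      c - kummerPruferHom W p W.zsmul_geomPoints_surjective_holds P₁ x ∈ selmerLocalKerPrimaryTorsion W E p) :
    Nat.card ↥(W.selmerGroupPInfty p ⊓ selmerLocalKerPrimaryTorsion W E p) =
      p ^ m * Nat.card (AddCommGroup.primaryComponent W.sha p) := by
  rw [natCard_strictSelmer_eq_pow_mul_natCard_map W p E hP₁ hgen hm hm1]
  congr 1
  have hmap : (W.selmerGroupPInfty p ⊓ selmerLocalKerPrimaryTorsion W E p).map (primaryH1ToH1 W p) =
      (W.selmerGroupPInfty p).map (primaryH1ToH1 W p) := by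
    refine le_antisymm (AddSubgroup.map_mono inf_le_left) ?_
    rintro _ ⟨c, hc, rfl⟩
    obtain ⟨x, hx⟩ := hsurj c hc
    have hgx : kummerPruferHom W p W.zsmul_geomPoints_surjective_holds P₁ x ∈ (primaryH1ToH1 W p).ker := by
      rw [← range_kummerPruferHom_eq_ker W p W.zsmul_geomPoints_surjective_holds hgen]
      exact ⟨x, rfl⟩
    refine ⟨c - kummerPruferHom W p W.zsmul_geomPoints_surjective_holds P₁ x, ⟨?_, hx⟩, ?_⟩
    · exact (W.selmerGroupPInfty p).sub_mem hc (ker_primaryH1ToH1_le_selmerGroupPInfty W p hgx)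
    · rw [map_sub, (AddMonoidHom.mem_ker).mp hgx, sub_zero]
  rw [hmap, map_primaryH1ToH1_selmerGroupPInfty W p W.zsmul_geomPoints_surjective_holds,
    AddSubgroup.card_map_of_injective W.sha.subtype_injective]

/-! ### §5 The surjectivity criterion «`Sel_{p^∞} = im κ + Sel_0`» from local data at `E` -/

omit [NumberField K] [W.IsElliptic] hp [PerfectField E] in
/-- Selmer classes at `E` land in the local Kummer part: if `c ∈ H¹(K, E[p^∞])` dies in `H¹(E, E(K̄_E))`
(`selmerLocalKerPrimary W E p`) then its restriction to `H¹(E, E(K̄_E)[p^∞])` dies in `H¹(E, E(K̄_E))`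
(functoriality of `H¹` along the two factorizations of `(resGal E, pointsMap ∘ incl)`).
Greenberg 1999 §2 p. 63; Silverman AEC X.§4 diagram (**). [folklore] -/
theorem res_mem_resKer_of_mem_selmerLocalKerPrimary {c : galH1Primary W p}
    (hc : c ∈ selmerLocalKerPrimary W E p) :
    resH1Hom (resGal (K := K) E) (primaryPointsMap W E p) (primaryPointsMap_smul W E p) c ∈
      resKer (ContinuousMonoidHom.id (Field.absoluteGaloisGroup E))
        (AddCommGroup.primaryComponent (localPoints W E) p).subtype (fun _ _ => rfl) := by
  rw [resKer_eq_ker, AddMonoidHom.mem_ker, ← AddMonoidHom.comp_apply, resH1Hom_comp]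
  have hc' : resH1Hom (resGal (K := K) E) ((pointsMap W E).comp (geomPrimaryTorsion W p).subtype)
      (fun σ P => by
        simp only [AddMonoidHom.coe_comp, AddSubgroup.coe_subtype, Function.comp_apply,
          Literature.NumberTheory.EllipticCurves.primaryComponent.coe_smul]
        exact pointsMap_smul W E σ P) c = 0 := hc
  rw [← hc']
  congr 1

omit [NumberField K] [W.IsElliptic] hp in
/-- `H¹(E, E(K̄_E)[p^∞])` is `p`-primary (`Γ_E` compact, coefficients `p`-primary and discrete: a
continuous cocycle takes finitely many values). Serre, Galois Cohomology, I.§2.2. [folklore] -/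
theorem exists_pow_smul_eq_zero_localH1Primary
    (y : discreteH1 (Field.absoluteGaloisGroup E) (AddCommGroup.primaryComponent (localPoints W E) p)) :
    ∃ n : ℕ, p ^ n • y = 0 := by
  haveI := compactSpace_absoluteGaloisGroup E
  obtain ⟨φ, rfl⟩ := oneCocycleClass_surjective _ y
  obtain ⟨N, hN⟩ := exists_pow_smul_apply_eq_zero (p := p) φ.1 fun g => by
    obtain ⟨k, hk⟩ := (AddCommGroup.mem_primaryComponent).mp (φ.1 g).2
    exact ⟨k, Subtype.ext hk⟩
  exact ⟨N, nsmul_oneCocycleClass_eq_zero φ (p ^ N) hN⟩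

/-- **THE SURJECTIVITY CRITERION «`Sel_{p^∞} = im κ + Sel_0`».** Suppose `Sel_{p^∞}(E/K)` satisfies the
Selmer condition at `E` (`hSelE`; automatic when `E` is one of the completions defining it), the
`E`-divisibility level `m` of `P₁` modulo torsion is finite (`hm1`), and the kernel `L_E` of
`H¹(E, E(K̄_E)[p^∞]) → H¹(E, E(K̄_E))` has at most `p` elements killed by `p` (`hL`; for `E = ℚ_p`:
`L_{ℚ_p} ≅ E(ℚ_p) ⊗ ℚ_p/ℤ_p ≅ ℚ_p/ℤ_p`, Kim 2022 Lemma 5.1 — NOT proved here). Then every Selmer class is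
locally trivial at `E` up to a class of the Kummer line of `P₁`. Proof: the restriction `R` of the Kummer
line is a non-zero (`hm1` + §2) `p`-divisible subgroup of the `p`-primary group `L_E`, hence all of `L_E`
(§1 `eq_top_of_divisible_of_card_torsion_le`), and `res_E(Sel_{p^∞}) ⊆ L_E`.
[cite: Kim2022StructureSelmer, §5.1 Lemma 5.1] -/
theorem forall_exists_sub_kummerPruferHom_mem {P₁ : W.toAffine.Point} {m : ℕ}
    (hm1 : ¬ ∃ R T : (W.baseChange E).toAffine.Point, IsOfFinAddOrder T ∧
      Affine.Point.baseChange (W' := W) K E P₁ = p ^ (m + 1) • R + T)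
    (hSelE : W.selmerGroupPInfty p ≤ selmerLocalKerPrimary W E p)
    (hL : ∀ S : Finset (discreteH1 (Field.absoluteGaloisGroup E)
        (AddCommGroup.primaryComponent (localPoints W E) p)),
      (∀ y ∈ S, y ∈ resKer (ContinuousMonoidHom.id (Field.absoluteGaloisGroup E))
          (AddCommGroup.primaryComponent (localPoints W E) p).subtype (fun _ _ => rfl) ∧ p • y = 0) →
        S.card ≤ p) :
    ∀ c ∈ W.selmerGroupPInfty p, ∃ x : PruferQuot p,
      c - kummerPruferHom W p W.zsmul_geomPoints_surjective_holds P₁ x ∈ selmerLocalKerPrimaryTorsion W E p := by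
  set resE := resH1Hom (resGal (K := K) E) (primaryPointsMap W E p) (primaryPointsMap_smul W E p)
    with hresE
  set L₀ := resKer (ContinuousMonoidHom.id (Field.absoluteGaloisGroup E))
    (AddCommGroup.primaryComponent (localPoints W E) p).subtype (fun _ _ => rfl) with hL₀
  set g := kummerPruferHom W p W.zsmul_geomPoints_surjective_holds P₁ with hg
  -- the restricted Kummer line `R ≤ L₀`
  set R : AddSubgroup _ := (g.range).map resE with hR
  have hRle : R ≤ L₀ := by
    rintro _ ⟨y, ⟨x, rfl⟩, rfl⟩
    refine res_mem_resKer_of_mem_selmerLocalKerPrimary W p E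
      (ker_primaryH1ToH1_le_selmerLocalKerPrimary W E p ?_)
    obtain ⟨N, a, rfl⟩ := exists_eq_zsmul_prufGen p x
    rw [AddMonoidHom.mem_ker, hg, map_zsmul, kummerPruferHom_prufGen, map_zsmul,
      primaryH1ToH1_kummerMapLevel]
    exact zsmul_zero a
  -- `R ≠ ⊥`: `κ_{m+1}(P₁)` is not locally trivial
  have hR0 : resE (g (prufGen p (m + 1))) ≠ 0 := by
    intro h0
    rw [hg, kummerPruferHom_prufGen, hresE, res_kummerMapLevel_eq_zero_iff] at h0
    exact hm1 h0
  -- apply the uniserial lemma inside the group `L₀`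
  set R' : AddSubgroup L₀ := R.addSubgroupOf L₀ with hR'
  have hR'top : R' = ⊤ := by
    refine eq_top_of_divisible_of_card_torsion_le hp.out ?_ ?_ R' ?_ ?_
    · intro y
      obtain ⟨n, hn⟩ := exists_pow_smul_eq_zero_localH1Primary W p E (y : _)
      exact ⟨n, Subtype.ext (by rw [AddSubgroupClass.coe_nsmul, hn]; rfl)⟩
    · intro S hS
      rw [← Finset.card_map ⟨Subtype.val, Subtype.val_injective⟩]
      refine hL _ fun y hy => ?_
      obtain ⟨y', hy', rfl⟩ := Finset.mem_map.mp hy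
      refine ⟨y'.2, ?_⟩
      change p • ((y' : L₀) : discreteH1 (Field.absoluteGaloisGroup E) (AddCommGroup.primaryComponent (localPoints W E) p)) = 0
      have h1 := congrArg Subtype.val (hS y' hy')
      rwa [AddSubgroupClass.coe_nsmul, ZeroMemClass.coe_zero] at h1
    · intro y hy
      rw [hR', AddSubgroup.mem_addSubgroupOf] at hy
      obtain ⟨z, ⟨x, rfl⟩, hz⟩ := hy
      obtain ⟨x', rfl⟩ := PruferQuot.divisible p (m := p) (Int.natCast_ne_zero.mpr hp.out.ne_zero) x
      refine ⟨⟨resE (g x'), hRle ⟨g x', ⟨x', rfl⟩, rfl⟩⟩, ?_, Subtype.ext ?_⟩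
      · rw [hR', AddSubgroup.mem_addSubgroupOf]
        exact ⟨g x', ⟨x', rfl⟩, rfl⟩
      · change p • resE (g x') = (y : discreteH1 (Field.absoluteGaloisGroup E) (AddCommGroup.primaryComponent (localPoints W E) p))
        rw [← hz, ← map_nsmul, ← map_nsmul, natCast_zsmul]
    · rw [AddSubgroup.ne_bot_iff_exists_ne_zero]
      refine ⟨⟨⟨resE (g (prufGen p (m + 1))), hRle ⟨_, ⟨_, rfl⟩, rfl⟩⟩, ?_⟩, ?_⟩
      · rw [hR', AddSubgroup.mem_addSubgroupOf]
        exact ⟨_, ⟨_, rfl⟩, rfl⟩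
      · intro h
        apply hR0
        rw [Subtype.ext_iff, Subtype.ext_iff] at h
        exact h
  -- conclude
  intro c hc
  have hcL : resE c ∈ L₀ := res_mem_resKer_of_mem_selmerLocalKerPrimary W p E (hSelE hc)
  have hcR : (⟨resE c, hcL⟩ : L₀) ∈ R' := by rw [hR'top]; exact AddSubgroup.mem_top _
  rw [hR', AddSubgroup.mem_addSubgroupOf] at hcR
  obtain ⟨z, ⟨x, rfl⟩, hz⟩ := hcR
  refine ⟨x, ?_⟩
  change resE (c - g x) = 0
  rw [map_sub, sub_eq_zero]
  exact hz.symm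

/-! ### §6 At a completion `K_v`: the Selmer condition is automatic -/

omit hp [W.IsElliptic] in
/-- At a finite place `v`, `Sel_{p^∞}(E/K)` satisfies the Selmer condition at `K_v` by definition. [folklore] -/
theorem selmerGroupPInfty_le_selmerLocalKerPrimary_adicCompletion [Fact p.Prime]
    (v : IsDedekindDomain.HeightOneSpectrum (NumberField.RingOfIntegers K)) :
    W.selmerGroupPInfty p ≤ selmerLocalKerPrimary W (v.adicCompletion K) p :=
  inf_le_left.trans (iInf_le _ v)

/-- **`#Sel_0 = p^m · #Ш(E/K)[p^∞]` at a finite place `v`**, with `Sel_0 = Sel_{p^∞}(E/K) ∩ ker (→ H¹(K_v, E[p^∞]))`,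
`m` = the `K_v`-divisibility level of the Mordell–Weil generator `P₁` modulo torsion, under the one local
hypothesis `hL` (the local Kummer part of `H¹(K_v, E[p^∞])` has `≤ p` elements killed by `p`; true iff
`[K_v : ℚ_p] ≤ 1`… i.e. for `K = ℚ`, where it is `E(ℚ_p) ⊗ ℚ_p/ℤ_p ≅ ℚ_p/ℤ_p` — not proved here). For
`K = ℚ`, `v = p` this is R1-DEPTH-LAW §2 (i): `length Sel_0(ℚ, E[p^∞]) = m_p + length Ш[p^∞]`.
[cite: Kim2022StructureSelmer, §5.1 eq. (5.1) and Lemma 5.1] -/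
theorem natCard_strictSelmer_adicCompletion_eq
    (v : IsDedekindDomain.HeightOneSpectrum (NumberField.RingOfIntegers K))
    {P₁ : W.toAffine.Point} (hP₁ : ¬ IsOfFinAddOrder P₁)
    (hgen : ∀ P : W.toAffine.Point, ∃ (a : ℤ) (t : W.toAffine.Point),
      IsOfFinAddOrder t ∧ P = a • P₁ + t) {m : ℕ}
    (hm : ∃ R T : (W.baseChange (v.adicCompletion K)).toAffine.Point, IsOfFinAddOrder T ∧
      Affine.Point.baseChange (W' := W) K (v.adicCompletion K) P₁ = p ^ m • R + T)
    (hm1 : ¬ ∃ R T : (W.baseChange (v.adicCompletion K)).toAffine.Point, IsOfFinAddOrder T ∧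
      Affine.Point.baseChange (W' := W) K (v.adicCompletion K) P₁ = p ^ (m + 1) • R + T)
    (hL : ∀ S : Finset (discreteH1 (Field.absoluteGaloisGroup (v.adicCompletion K))
        (AddCommGroup.primaryComponent (localPoints W (v.adicCompletion K)) p)),
      (∀ y ∈ S, y ∈ resKer (ContinuousMonoidHom.id (Field.absoluteGaloisGroup (v.adicCompletion K)))
          (AddCommGroup.primaryComponent (localPoints W (v.adicCompletion K)) p).subtype
            (fun _ _ => rfl) ∧ p • y = 0) → S.card ≤ p) :
    Nat.card ↥(W.selmerGroupPInfty p ⊓ selmerLocalKerPrimaryTorsion W (v.adicCompletion K) p) =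
      p ^ m * Nat.card (AddCommGroup.primaryComponent W.sha p) := by
  haveI : CharZero (v.adicCompletion K) :=
    charZero_of_injective_algebraMap (algebraMap K (v.adicCompletion K)).injective
  haveI : PerfectField (v.adicCompletion K) := PerfectField.ofCharZero
  exact natCard_strictSelmer_eq_pow_mul_natCard_sha W p (v.adicCompletion K) hP₁ hgen hm hm1
    (forall_exists_sub_kummerPruferHom_mem W p (v.adicCompletion K) hm1
      (selmerGroupPInfty_le_selmerLocalKerPrimary_adicCompletion W p v) hL)

end StrictSelmer

end Summit.BirchSwinnertonDyer.Rank1Residual.Ordinary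

end
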